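import Summits.NavierStokesRegularity.NavierStokesRegularity.Theorems.ScaledTopAlignmentAprioriMostTimesBulkAlignmentNearMaxOfUniversalLaws
import Summits.NavierStokesRegularity.NavierStokesRegularity.Theorems.ScaledTopAlignmentNearMaxLawGoodRatePoints
import Summits.NavierStokesRegularity.NavierStokesRegularity.Theorems.TypeILiouvilleTypeIliouvilleNoTypeIIDoorCalculus
import HarnessLib

/-!
# Route `ScaledTopAlignment`, crux W3ᵐᵗ = `AprioriMostTimesBulkAlignment` (stmt-NavierStokesRegularity-19551),
# registered line `nearmax` (open stub `stub_nearMaxMostTimes`): the stub FROM THE BUDGET-CURRENCY LAW UDW∞ —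
# the planner's LAW-M package with BOTH glue stubs discharged (kernel composition)

The cell planner's LAW-M package (nsreg-p3 ROUND-10, `round-10/Law10-rev2.lean`) reads: the universal near-max
window-coherence law in the BUDGET currency of the frozen instrument BUDGET-9,
`UniversalNearMaxWindowCoherenceLaw θ λ₀ R₀ = ∀ δ > 0 ∃ A > 0, UniversalNearMaxWindowCoherence δ θ λ₀ R₀ A`
(UDW∞: in every classical Leray–Hopf flow from rapidly decaying data with `‖curl u₀‖ ≤ m₀`, on every `[0,T']`,
the saturation mass `∬|ω|^{5/2}/ν` of `A·m₀`-amplified `λ₀`-near-maximal points with a more-than-`δ`-decoherent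
near-max window is `≤ θ ×` that of all amplified near-maximal points), PLUS two glue stubs G1
(`stub_alignedProfile_of_lawM`, size L) and S2 (`stub_exactKill`, size M), gives `ThreadingFlux.Target` and,
with the residual NoTypeII, Clay (A). Both glue stubs are now tree theorems:

* S2 and the zoom/Fatou half of G1 = `typeI_uniform_window_budget_decoherence`
  (`ScaledTopAlignmentTypeIBlowupBudgetPortrait`): near a Type-I singular time EVERY rate-near-maximal window is
  uniformly budget-decoherent;
* the selection half of G1 = `exists_goodRatePoint_of_nearMaxWindowCoherence`
  (`ScaledTopAlignmentNearMaxLawGoodRatePoints`): the law instance yields late rate points with δ-GOOD windows.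

Hence, kernel-checked and free of stubs:

* `threadingFluxTarget_of_nearMaxWindowCoherenceLaw` — **UDW∞ (θ < 1, 0 < λ₀ < 1, R₀ > 0) ⇒ `ThreadingFlux.Target`**
  (stmt-NavierStokesRegularity-1217; the planner's `target_of_lawM` with G1, S2 discharged);
* `aprioriMostTimesBulkAlignment_of_nearMaxWindowCoherenceLaw_of_typeIIResidue` — UDW∞ ∧ R_II (the line's
  shared STUB 2) ⇒ the CRUX `AprioriMostTimesBulkAlignment` by name;
* `nearMaxMostTimesDoor_of_nearMaxWindowCoherenceLaw_of_typeIIResidue` — UDW∞ ∧ R_II ⇒ the registered STUB 1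
  `Nearmax.stub_nearMaxMostTimes` LITERALLY (its signature is the conclusion);
* `navierStokesRegularity_of_nearMaxWindowCoherenceLaw_of_noTypeII` — UDW∞ ∧ NoTypeII ⇒ Clay (A) (the planner's
  `closesM`, now with no sorry anywhere);
* `typeI_uniform_nearMax_window_budget_decoherence` — the instrument-facing Type-I portrait: near a Type-I singular
  time EVERY relative near-maximum `λ₀ sup|ω(t)| ≤ |ω(t,x)|` (the points the BUDGET-9 statistic reads) has a window
  MORE than `δ`-decoherent, uniformly at all late times.

So the typed law UDW∞ — whose content lives on REGULAR flows and is what the cell's certified instrument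
(BUDGET-9 / S1-low legs, PREREG-9) measures — DECIDES the registered stub and the crux modulo the line's STUB 2,
and the route's summit claim modulo the residual. hard core evaded: none — UDW∞ IMPLIES Target (1217); NoTypeII
(0056) is the residual. WHAT THIS IS NOT: not NS regularity and not a proof of UDW∞ or of the stub; a kernel
composition with a frontier law as hypothesis (a certified refutation of UDW∞ kills this glue path, not the stub).
[folklore]
-/

noncomputable section

-- the summit and its single sub-problem share the name (CONVENTIONS §1), as in every Theorems file
set_option linter.dupNamespace false

open MeasureTheory Set Function Filter Topology Metric
open scoped RealInnerProductSpace ENNReal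
open Literature.Analysis Literature.Analysis.FluidPDE

namespace Summit.NavierStokesRegularity.NavierStokesRegularity.Theorems

/-! ### Form M: the universal near-max window-coherence law in the budget currency -/

/-- **UDW∞ ⇒ the hard core `ThreadingFlux.Target`** (stmt-NavierStokesRegularity-1217: no Type-I first blow-up in
the class). Hypothesis = the body of the planner's `UniversalNearMaxWindowCoherenceLaw θ λ₀ R₀` (`∀ δ > 0 ∃ A > 0`,
UDW(δ, θ, λ₀, R₀, A) on every classical Leray–Hopf flow from rapidly decaying data, every datum bound `m₀`, every
`[0, T']`), with `windowSat` / `windowBudget` / `satDensity` unfolded and the direction field spelled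
`vorticityDirection`. Per solution with a Type-I first blow-up: the flow-side portrait
`typeI_uniform_window_budget_decoherence` gives `δ` and `t₁` making every late `κ`-rate window MORE than
`δ`-decoherent (`κ` the selection's rate floor), the law at this `δ` gives a gate `A`, and the selection
`exists_goodRatePoint_of_nearMaxWindowCoherence` produces a late `κ`-rate point with a `δ`-GOOD window — absurd.
[folklore] -/
theorem threadingFluxTarget_of_nearMaxWindowCoherenceLaw {θ lam0 R0 : ℝ} (hθ : θ < 1) (hlam0 : 0 < lam0)
    (hlam1 : lam0 < 1) (hR0 : 0 < R0)
    (hL : ∀ δ : ℝ, 0 < δ → ∃ A : ℝ, 0 < A ∧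
      ∀ (ν T : ℝ), 0 < ν → 0 < T → ∀ (u : ℝ → EuclideanSpace ℝ (Fin 3) → EuclideanSpace ℝ (Fin 3))
        (p : ℝ → EuclideanSpace ℝ (Fin 3) → ℝ),
        IsClassicalNSSolutionOn (Set.Ico 0 T) ν 0 u p → IsLerayHopfOn T ν 0 (u 0) u → HasRapidSpatialDecay (u 0) →
        ∀ m0 : ℝ, 0 < m0 → (∀ x, ‖curl (u 0) x‖ ≤ m0) → ∀ T' : ℝ, 0 < T' → T' < T →
          (∫⁻ t in Set.Icc 0 T', ∫⁻ x in {x : EuclideanSpace ℝ (Fin 3) |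
              lam0 * (⨆ z, ‖curl (u t) z‖) ≤ ‖curl (u t) x‖ ∧ A * m0 ≤ ‖curl (u t) x‖ ∧
              ENNReal.ofReal δ *
                  (∫⁻ y in {y : EuclideanSpace ℝ (Fin 3) | lam0 * ‖curl (u t) x‖ ≤ ‖curl (u t) y‖ ∧
                      ‖y - x‖ ≤ R0 * Real.sqrt (ν / ‖curl (u t) x‖)},
                    ENNReal.ofReal (‖curl (u t) y‖ ^ (5 / 2 : ℝ) / ν)) <
                ∫⁻ y in {y : EuclideanSpace ℝ (Fin 3) | lam0 * ‖curl (u t) x‖ ≤ ‖curl (u t) y‖ ∧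
                    ‖y - x‖ ≤ R0 * Real.sqrt (ν / ‖curl (u t) x‖)},
                  ENNReal.ofReal (‖curl (u t) y‖ ^ (3 / 2 : ℝ) *
                    ‖fderiv ℝ (vorticityDirection (curl (u t))) y‖ ^ 2)},
              ENNReal.ofReal (‖curl (u t) x‖ ^ (5 / 2 : ℝ) / ν)) ≤
          ENNReal.ofReal θ *
            ∫⁻ t in Set.Icc 0 T', ∫⁻ x in {x : EuclideanSpace ℝ (Fin 3) |
                lam0 * (⨆ z, ‖curl (u t) z‖) ≤ ‖curl (u t) x‖ ∧ A * m0 ≤ ‖curl (u t) x‖},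
              ENNReal.ofReal (‖curl (u t) x‖ ^ (5 / 2 : ℝ) / ν)) :
    Summit.NavierStokesRegularity.NavierStokesRegularity.Theses.ThreadingFlux.Target := by
  intro ν T hν hT u p hcl hLH hdec hI
  by_contra hext
  obtain ⟨κ, hκ, hsel⟩ := exists_goodRatePoint_of_nearMaxWindowCoherence hν hT hcl hLH hdec hI hext hlam0 hlam1
  obtain ⟨δ, hδ, t₁, ht₁, hB⟩ := typeI_uniform_window_budget_decoherence hν hT hcl hLH hdec hI hκ hlam1 hR0
  obtain ⟨A, hA, hLA⟩ := hL δ hδ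
  obtain ⟨t, ht, x, hrate, hgood⟩ := hsel δ θ R0 A hθ hA
    (fun m0 hm0 hbd T' hT'0 hT'T => hLA ν T hν hT u p hcl hLH hdec m0 hm0 hbd T' hT'0 hT'T) t₁ ht₁
  exact absurd hgood (not_le.2 (hB t ht x hrate))

/-- **UDW∞ ∧ R_II ⇒ the CRUX by name.** With the Type-II residue R_II (the line's STUB 2 `stub_typeIIResidue`,
shared with `Lines/recurrent.lean`; vacuous under the route's residual NoTypeII) the budget-currency law gives the
deciding crux `AprioriMostTimesBulkAlignment` (stmt-NavierStokesRegularity-19551), through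
`aprioriMostTimesBulkAlignment_iff_target_and_typeII`. [folklore] -/
theorem aprioriMostTimesBulkAlignment_of_nearMaxWindowCoherenceLaw_of_typeIIResidue {θ lam0 R0 : ℝ}
    (hθ : θ < 1) (hlam0 : 0 < lam0) (hlam1 : lam0 < 1) (hR0 : 0 < R0)
    (hL : ∀ δ : ℝ, 0 < δ → ∃ A : ℝ, 0 < A ∧
      ∀ (ν T : ℝ), 0 < ν → 0 < T → ∀ (u : ℝ → EuclideanSpace ℝ (Fin 3) → EuclideanSpace ℝ (Fin 3))
        (p : ℝ → EuclideanSpace ℝ (Fin 3) → ℝ),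
        IsClassicalNSSolutionOn (Set.Ico 0 T) ν 0 u p → IsLerayHopfOn T ν 0 (u 0) u → HasRapidSpatialDecay (u 0) →
        ∀ m0 : ℝ, 0 < m0 → (∀ x, ‖curl (u 0) x‖ ≤ m0) → ∀ T' : ℝ, 0 < T' → T' < T →
          (∫⁻ t in Set.Icc 0 T', ∫⁻ x in {x : EuclideanSpace ℝ (Fin 3) |
              lam0 * (⨆ z, ‖curl (u t) z‖) ≤ ‖curl (u t) x‖ ∧ A * m0 ≤ ‖curl (u t) x‖ ∧
              ENNReal.ofReal δ *
                  (∫⁻ y in {y : EuclideanSpace ℝ (Fin 3) | lam0 * ‖curl (u t) x‖ ≤ ‖curl (u t) y‖ ∧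
                      ‖y - x‖ ≤ R0 * Real.sqrt (ν / ‖curl (u t) x‖)},
                    ENNReal.ofReal (‖curl (u t) y‖ ^ (5 / 2 : ℝ) / ν)) <
                ∫⁻ y in {y : EuclideanSpace ℝ (Fin 3) | lam0 * ‖curl (u t) x‖ ≤ ‖curl (u t) y‖ ∧
                    ‖y - x‖ ≤ R0 * Real.sqrt (ν / ‖curl (u t) x‖)},
                  ENNReal.ofReal (‖curl (u t) y‖ ^ (3 / 2 : ℝ) *
                    ‖fderiv ℝ (vorticityDirection (curl (u t))) y‖ ^ 2)},
              ENNReal.ofReal (‖curl (u t) x‖ ^ (5 / 2 : ℝ) / ν)) ≤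
          ENNReal.ofReal θ *
            ∫⁻ t in Set.Icc 0 T', ∫⁻ x in {x : EuclideanSpace ℝ (Fin 3) |
                lam0 * (⨆ z, ‖curl (u t) z‖) ≤ ‖curl (u t) x‖ ∧ A * m0 ≤ ‖curl (u t) x‖},
              ENNReal.ofReal (‖curl (u t) x‖ ^ (5 / 2 : ℝ) / ν))
    (hRII : ∀ (ν T : ℝ), 0 < ν → 0 < T → ∀ (u : ℝ → EuclideanSpace ℝ (Fin 3) → EuclideanSpace ℝ (Fin 3))
        (p : ℝ → EuclideanSpace ℝ (Fin 3) → ℝ),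
        IsClassicalNSSolutionOn (Set.Ico 0 T) ν 0 u p → IsLerayHopfOn T ν 0 (u 0) u →
        HasRapidSpatialDecay (u 0) → ¬ HasSmoothExtensionPast ν 0 u T → ¬ IsTypeIBlowup u T →
        ∃ lam0 : ℝ, lam0 < 1 ∧ ∃ R0 : ℝ, 0 < R0 ∧ ∃ θ : ℝ, θ < 1 ∧ ∀ κ : ℝ, 0 < κ → ∀ ε : ℝ, 0 < ε →
          ∀ δ : ℝ, 0 < δ → ∃ M : ℝ, 0 < M ∧ ∃ E : Set ℝ,
            (∃ h0 : ℝ, 0 < h0 ∧ ∀ h : ℝ, 0 < h → h < h0 →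
              volume (E ∩ Set.Ioo (T - h) T) ≤ ENNReal.ofReal (θ * h)) ∧
            ∀ t ∈ Set.Ico 0 T, t ∉ E → ∀ x : EuclideanSpace ℝ (Fin 3), M ≤ ‖curl (u t) x‖ →
              κ / (T - t) ≤ ‖curl (u t) x‖ →
              volume {y : EuclideanSpace ℝ (Fin 3) | lam0 * ‖curl (u t) x‖ ≤ ‖curl (u t) y‖ ∧
                  ‖x - y‖ ≤ R0 * Real.sqrt (ν / ‖curl (u t) x‖) ∧
                  ε < Real.sqrt (1 - (inner ℝ (‖curl (u t) x‖⁻¹ • curl (u t) x)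
                    (‖curl (u t) y‖⁻¹ • curl (u t) y)) ^ 2)}
                ≤ ENNReal.ofReal (δ * Real.sqrt (ν / ‖curl (u t) x‖) ^ 3)) :
    Summit.NavierStokesRegularity.NavierStokesRegularity.Theses.ScaledTopAlignment.AprioriMostTimesBulkAlignment :=
  aprioriMostTimesBulkAlignment_iff_target_and_typeII.mpr
    ⟨threadingFluxTarget_of_nearMaxWindowCoherenceLaw hθ hlam0 hlam1 hR0 hL, hRII⟩

/-- **UDW∞ ∧ R_II ⇒ STUB 1 of line `nearmax`, literally** (the conclusion is the signature of the registered stub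
`Nearmax.stub_nearMaxMostTimes`): through the crux and the landed rung
`nearMaxMostTimesBulkAlignment_of_aprioriMostTimesBulkAlignment`. [folklore] -/
theorem nearMaxMostTimesDoor_of_nearMaxWindowCoherenceLaw_of_typeIIResidue {θ lam0 R0 : ℝ}
    (hθ : θ < 1) (hlam0 : 0 < lam0) (hlam1 : lam0 < 1) (hR0 : 0 < R0)
    (hL : ∀ δ : ℝ, 0 < δ → ∃ A : ℝ, 0 < A ∧
      ∀ (ν T : ℝ), 0 < ν → 0 < T → ∀ (u : ℝ → EuclideanSpace ℝ (Fin 3) → EuclideanSpace ℝ (Fin 3))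
        (p : ℝ → EuclideanSpace ℝ (Fin 3) → ℝ),
        IsClassicalNSSolutionOn (Set.Ico 0 T) ν 0 u p → IsLerayHopfOn T ν 0 (u 0) u → HasRapidSpatialDecay (u 0) →
        ∀ m0 : ℝ, 0 < m0 → (∀ x, ‖curl (u 0) x‖ ≤ m0) → ∀ T' : ℝ, 0 < T' → T' < T →
          (∫⁻ t in Set.Icc 0 T', ∫⁻ x in {x : EuclideanSpace ℝ (Fin 3) |
              lam0 * (⨆ z, ‖curl (u t) z‖) ≤ ‖curl (u t) x‖ ∧ A * m0 ≤ ‖curl (u t) x‖ ∧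
              ENNReal.ofReal δ *
                  (∫⁻ y in {y : EuclideanSpace ℝ (Fin 3) | lam0 * ‖curl (u t) x‖ ≤ ‖curl (u t) y‖ ∧
                      ‖y - x‖ ≤ R0 * Real.sqrt (ν / ‖curl (u t) x‖)},
                    ENNReal.ofReal (‖curl (u t) y‖ ^ (5 / 2 : ℝ) / ν)) <
                ∫⁻ y in {y : EuclideanSpace ℝ (Fin 3) | lam0 * ‖curl (u t) x‖ ≤ ‖curl (u t) y‖ ∧
                    ‖y - x‖ ≤ R0 * Real.sqrt (ν / ‖curl (u t) x‖)},
                  ENNReal.ofReal (‖curl (u t) y‖ ^ (3 / 2 : ℝ) *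
                    ‖fderiv ℝ (vorticityDirection (curl (u t))) y‖ ^ 2)},
              ENNReal.ofReal (‖curl (u t) x‖ ^ (5 / 2 : ℝ) / ν)) ≤
          ENNReal.ofReal θ *
            ∫⁻ t in Set.Icc 0 T', ∫⁻ x in {x : EuclideanSpace ℝ (Fin 3) |
                lam0 * (⨆ z, ‖curl (u t) z‖) ≤ ‖curl (u t) x‖ ∧ A * m0 ≤ ‖curl (u t) x‖},
              ENNReal.ofReal (‖curl (u t) x‖ ^ (5 / 2 : ℝ) / ν))
    (hRII : ∀ (ν T : ℝ), 0 < ν → 0 < T → ∀ (u : ℝ → EuclideanSpace ℝ (Fin 3) → EuclideanSpace ℝ (Fin 3))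
        (p : ℝ → EuclideanSpace ℝ (Fin 3) → ℝ),
        IsClassicalNSSolutionOn (Set.Ico 0 T) ν 0 u p → IsLerayHopfOn T ν 0 (u 0) u →
        HasRapidSpatialDecay (u 0) → ¬ HasSmoothExtensionPast ν 0 u T → ¬ IsTypeIBlowup u T →
        ∃ lam0 : ℝ, lam0 < 1 ∧ ∃ R0 : ℝ, 0 < R0 ∧ ∃ θ : ℝ, θ < 1 ∧ ∀ κ : ℝ, 0 < κ → ∀ ε : ℝ, 0 < ε →
          ∀ δ : ℝ, 0 < δ → ∃ M : ℝ, 0 < M ∧ ∃ E : Set ℝ,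
            (∃ h0 : ℝ, 0 < h0 ∧ ∀ h : ℝ, 0 < h → h < h0 →
              volume (E ∩ Set.Ioo (T - h) T) ≤ ENNReal.ofReal (θ * h)) ∧
            ∀ t ∈ Set.Ico 0 T, t ∉ E → ∀ x : EuclideanSpace ℝ (Fin 3), M ≤ ‖curl (u t) x‖ →
              κ / (T - t) ≤ ‖curl (u t) x‖ →
              volume {y : EuclideanSpace ℝ (Fin 3) | lam0 * ‖curl (u t) x‖ ≤ ‖curl (u t) y‖ ∧
                  ‖x - y‖ ≤ R0 * Real.sqrt (ν / ‖curl (u t) x‖) ∧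
                  ε < Real.sqrt (1 - (inner ℝ (‖curl (u t) x‖⁻¹ • curl (u t) x)
                    (‖curl (u t) y‖⁻¹ • curl (u t) y)) ^ 2)}
                ≤ ENNReal.ofReal (δ * Real.sqrt (ν / ‖curl (u t) x‖) ^ 3)) :
    ∀ (ν T : ℝ), 0 < ν → 0 < T → ∀ (u : ℝ → EuclideanSpace ℝ (Fin 3) → EuclideanSpace ℝ (Fin 3))
      (p : ℝ → EuclideanSpace ℝ (Fin 3) → ℝ), IsClassicalNSSolutionOn (Set.Ico 0 T) ν 0 u p →
      IsLerayHopfOn T ν 0 (u 0) u → HasRapidSpatialDecay (u 0) →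
      ∃ lam0 : ℝ, lam0 < 1 ∧ ∃ R0 : ℝ, 0 < R0 ∧ ∃ θ : ℝ, θ < 1 ∧ ∀ κ : ℝ, 0 < κ → ∀ q : ℝ, 0 < q →
        ∀ ε : ℝ, 0 < ε → ∀ δ : ℝ, 0 < δ → ∃ M : ℝ, 0 < M ∧ ∃ E : Set ℝ,
        (∃ h0 : ℝ, 0 < h0 ∧ ∀ h : ℝ, 0 < h → h < h0 →
          MeasureTheory.volume (E ∩ Set.Ioo (T - h) T) ≤ ENNReal.ofReal (θ * h)) ∧
        ∀ t ∈ Set.Ico 0 T, t ∉ E → ∀ x : EuclideanSpace ℝ (Fin 3), M ≤ ‖curl (u t) x‖ →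
        κ / (T - t) ≤ ‖curl (u t) x‖ → (∀ x' : EuclideanSpace ℝ (Fin 3), q * ‖curl (u t) x'‖ ≤ ‖curl (u t) x‖) →
          MeasureTheory.volume {y : EuclideanSpace ℝ (Fin 3) | lam0 * ‖curl (u t) x‖ ≤ ‖curl (u t) y‖ ∧
              ‖x - y‖ ≤ R0 * Real.sqrt (ν / ‖curl (u t) x‖) ∧
              ε < Real.sqrt (1 - (inner ℝ (‖curl (u t) x‖⁻¹ • curl (u t) x)
                (‖curl (u t) y‖⁻¹ • curl (u t) y)) ^ 2)}
            ≤ ENNReal.ofReal (δ * Real.sqrt (ν / ‖curl (u t) x‖) ^ 3) :=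
  nearMaxMostTimesBulkAlignment_of_aprioriMostTimesBulkAlignment
    (aprioriMostTimesBulkAlignment_of_nearMaxWindowCoherenceLaw_of_typeIIResidue hθ hlam0 hlam1 hR0 hL hRII)

/-- **UDW∞ ∧ NoTypeII ⇒ Clay (A)** (the planner's `closesM`, both glue stubs discharged): through
`navierStokesRegularity_of_target_of_typeIliouvilleNoTypeII`; the residual is taken in the route's own spelling
`Theses.ScaledTopAlignment.NoTypeII` (definitionally the TypeILiouville shape). [folklore] -/
theorem navierStokesRegularity_of_nearMaxWindowCoherenceLaw_of_noTypeII {θ lam0 R0 : ℝ} (hθ : θ < 1)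
    (hlam0 : 0 < lam0) (hlam1 : lam0 < 1) (hR0 : 0 < R0)
    (hL : ∀ δ : ℝ, 0 < δ → ∃ A : ℝ, 0 < A ∧
      ∀ (ν T : ℝ), 0 < ν → 0 < T → ∀ (u : ℝ → EuclideanSpace ℝ (Fin 3) → EuclideanSpace ℝ (Fin 3))
        (p : ℝ → EuclideanSpace ℝ (Fin 3) → ℝ),
        IsClassicalNSSolutionOn (Set.Ico 0 T) ν 0 u p → IsLerayHopfOn T ν 0 (u 0) u → HasRapidSpatialDecay (u 0) →
        ∀ m0 : ℝ, 0 < m0 → (∀ x, ‖curl (u 0) x‖ ≤ m0) → ∀ T' : ℝ, 0 < T' → T' < T →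
          (∫⁻ t in Set.Icc 0 T', ∫⁻ x in {x : EuclideanSpace ℝ (Fin 3) |
              lam0 * (⨆ z, ‖curl (u t) z‖) ≤ ‖curl (u t) x‖ ∧ A * m0 ≤ ‖curl (u t) x‖ ∧
              ENNReal.ofReal δ *
                  (∫⁻ y in {y : EuclideanSpace ℝ (Fin 3) | lam0 * ‖curl (u t) x‖ ≤ ‖curl (u t) y‖ ∧
                      ‖y - x‖ ≤ R0 * Real.sqrt (ν / ‖curl (u t) x‖)},
                    ENNReal.ofReal (‖curl (u t) y‖ ^ (5 / 2 : ℝ) / ν)) <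
                ∫⁻ y in {y : EuclideanSpace ℝ (Fin 3) | lam0 * ‖curl (u t) x‖ ≤ ‖curl (u t) y‖ ∧
                    ‖y - x‖ ≤ R0 * Real.sqrt (ν / ‖curl (u t) x‖)},
                  ENNReal.ofReal (‖curl (u t) y‖ ^ (3 / 2 : ℝ) *
                    ‖fderiv ℝ (vorticityDirection (curl (u t))) y‖ ^ 2)},
              ENNReal.ofReal (‖curl (u t) x‖ ^ (5 / 2 : ℝ) / ν)) ≤
          ENNReal.ofReal θ *
            ∫⁻ t in Set.Icc 0 T', ∫⁻ x in {x : EuclideanSpace ℝ (Fin 3) |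
                lam0 * (⨆ z, ‖curl (u t) z‖) ≤ ‖curl (u t) x‖ ∧ A * m0 ≤ ‖curl (u t) x‖},
              ENNReal.ofReal (‖curl (u t) x‖ ^ (5 / 2 : ℝ) / ν))
    (hII : Summit.NavierStokesRegularity.NavierStokesRegularity.Theses.ScaledTopAlignment.NoTypeII) :
    NavierStokesRegularity :=
  navierStokesRegularity_of_target_of_typeIliouvilleNoTypeII
    (threadingFluxTarget_of_nearMaxWindowCoherenceLaw hθ hlam0 hlam1 hR0 hL) hII

/-! ### The instrument-facing portrait: relative near-maxima near a Type-I singular time -/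

/-- **Type-I blow-up portrait, budget currency, at RELATIVE near-maxima** (the instrument-facing form: the cell's
BUDGET-9 statistic reads windows at points near-maximal relative to the slice supremum). For a classical Leray–Hopf
solution from a rapidly decaying datum with the Type-I rate at `T` and no smooth extension past `T`, and
`0 < λ₀ < 1`, `R₀ > 0`: there are `δ > 0` and `t₁ < T` such that at EVERY point `(t, x)`, `t ∈ [t₁, T)`, with
`λ₀ sup_z |ω(t,z)| ≤ |ω(t,x)|`, the near-max window is more than `δ`-decoherent:
`δ · ∫_S |ω|^{5/2}/ν < ∫_S |ω|^{3/2}‖∇ξ‖²`. A relative near-maximum is a rate point by the lower Type-I vorticity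
rate (`lower_vorticity_rate`; the slice supremum is a true supremum by `upper_vorticity_rate`), so
`typeI_uniform_window_budget_decoherence` applies with `κ = λ₀ c`. [folklore] -/
theorem typeI_uniform_nearMax_window_budget_decoherence {ν T : ℝ} (hν : 0 < ν) (hT : 0 < T)
    {u : ℝ → EuclideanSpace ℝ (Fin 3) → EuclideanSpace ℝ (Fin 3)} {p : ℝ → EuclideanSpace ℝ (Fin 3) → ℝ}
    (hsol : IsClassicalNSSolutionOn (Ico 0 T) ν 0 u p) (hLH : IsLerayHopfOn T ν 0 (u 0) u)
    (hdec : HasRapidSpatialDecay (u 0)) (hI : IsTypeIBlowup u T) (hext : ¬ HasSmoothExtensionPast ν 0 u T)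
    {lam0 R0 : ℝ} (hlam0 : 0 < lam0) (hlam1 : lam0 < 1) (hR0 : 0 < R0) :
    ∃ δ : ℝ, 0 < δ ∧ ∃ t₁ ∈ Ico 0 T, ∀ t ∈ Ico t₁ T, ∀ x : EuclideanSpace ℝ (Fin 3),
      lam0 * (⨆ z, ‖curl (u t) z‖) ≤ ‖curl (u t) x‖ →
        ENNReal.ofReal δ *
          (∫⁻ y in {y : EuclideanSpace ℝ (Fin 3) | lam0 * ‖curl (u t) x‖ ≤ ‖curl (u t) y‖ ∧
              ‖y - x‖ ≤ R0 * Real.sqrt (ν / ‖curl (u t) x‖)}, ENNReal.ofReal (‖curl (u t) y‖ ^ (5 / 2 : ℝ) / ν)) <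
        ∫⁻ y in {y : EuclideanSpace ℝ (Fin 3) | lam0 * ‖curl (u t) x‖ ≤ ‖curl (u t) y‖ ∧
              ‖y - x‖ ≤ R0 * Real.sqrt (ν / ‖curl (u t) x‖)},
            ENNReal.ofReal (‖curl (u t) y‖ ^ (3 / 2 : ℝ) *
              ‖fderiv ℝ (vorticityDirection (curl (u t))) y‖ ^ 2) := by
  obtain ⟨Cω, tω, htω, hup⟩ := TubeAlternative.AnalyticPropagation.upper_vorticity_rate hν hT hsol hLH hdec hI
  obtain ⟨c, hc, tc, htc, hlow⟩ :=
    TubeAlternative.AnalyticPropagation.lower_vorticity_rate hν hT ⟨hsol, hext⟩ hLH hdec hI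
  have hκ : 0 < lam0 * c := by positivity
  obtain ⟨δ, hδ, t₁, ht₁, hB⟩ := typeI_uniform_window_budget_decoherence hν hT hsol hLH hdec hI hκ hlam1 hR0
  set t₂ : ℝ := max (max t₁ tω) tc with ht₂
  have ht₂T : t₂ < T := max_lt (max_lt ht₁.2 htω.2) htc.2
  have ht₂0 : 0 ≤ t₂ := ht₁.1.trans ((le_max_left _ _).trans (le_max_left _ _))
  refine ⟨δ, hδ, t₂, ⟨ht₂0, ht₂T⟩, fun t ht x hx => hB t ⟨((le_max_left _ _).trans (le_max_left _ _)).trans ht.1, ht.2⟩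
    x ?_⟩
  -- a relative near-maximum is a rate point
  have htω' : t ∈ Ico tω T := ⟨((le_max_right _ _).trans (le_max_left _ _)).trans ht.1, ht.2⟩
  have htc' : t ∈ Ico tc T := ⟨(le_max_right _ _).trans ht.1, ht.2⟩
  have hbdd : BddAbove (range fun z => ‖curl (u t) z‖) :=
    ⟨Cω / (T - t), by rintro _ ⟨z, rfl⟩; exact hup t htω' z⟩
  obtain ⟨x', hx'⟩ := hlow t htc'
  have hsup : c / (T - t) ≤ ⨆ z, ‖curl (u t) z‖ := hx'.trans (le_ciSup hbdd x')
  calc lam0 * c / (T - t) = lam0 * (c / (T - t)) := by ring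
    _ ≤ lam0 * ⨆ z, ‖curl (u t) z‖ := mul_le_mul_of_nonneg_left hsup hlam0.le
    _ ≤ ‖curl (u t) x‖ := hx

end Summit.NavierStokesRegularity.NavierStokesRegularity.Theorems

end
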